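import Literature.AnabelianGeometry.SemiGraphs.PSCCompactifiedLevelBridge
import Literature.AnabelianGeometry.SemiGraphs.PSCCoveringBranchData
import HarnessLib

/-!
# [CombGC] Thm. 1.6 (ii), descent step (route 2 of the cell's assembly): from "`β_U : Π^unr_{G_U} ≅ Π^unr_{H_{U'}}`
# is group-theoretically verticial" at every level to "`α` is group-theoretically verticial"

Mochizuki, *A combinatorial version of the Grothendieck conjecture*, Tohoku Math. J. **59** (2007) [CombGC],
proof of Theorem 1.6 (ii), author's ms p. 14 l.22–31: "`α` induces a verticially filtration-preserving
isomorphism `Π^unr_G ⥲ Π^unr_H`.  Now to prove that `α` is group-theoretically verticial, it suffices to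
prove [cf. the proof of assertion (i)] that `α` induces a functorial bijection between the sets of vertices
of `G`, `H`.  Thus … it suffices to prove that `β` is group-theoretically verticial, that is to say, it
suffices to verify assertion (iii)" (render `paper:url-6994f81053dc` p0014); Proposition 1.2 (i),
unramified case, p. 8. [cite: MochizukiCombGC2007, Thm 1.6(ii) p.14]

PROOF-ONLY file (abc-iut cell, layer L3, `plan/L3/SUBDAG-CombGC-Thm16.md` row T16-L09b, writer's ruling
v6 "ROUTE 2 … WANT 2", holder abc-iut-w5-d188).  The UNRAMIFIED twin of `PSCCompactifiedLevelBridge.lean`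
(p423150): at a level `U` (open normal of finite index in `Π_G`, `U' = α U`), with the covering data
`G_U := G.restrictBD U hU bd`, `H_{U'} := H.restrictBD U' hU' bd'` (abc-iut-L3-t4, p420475; their verticial
groups and `Ker(↠ Π^unr)` do not depend on the branch data, `restrictBD_vertGp` / `restrictBD_unrKer`),
an isomorphism `β_U : Π_{G_U} ⧸ Ker(↠ Π^unr) ≅ Π_{H_{U'}} ⧸ Ker(↠ Π^unr)` lying over `α|_U` which is
GROUP-THEORETICALLY VERTICIAL (Def. 1.4 (iv) for `β`, `IsUnrGroupTheoreticallyVerticial`), and Prop. 1.2 (i),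
unramified case (`UnrVerticialOpenInterDeterminesVertex`, for the sturdy `G_U` and `H_{U'}`, BY NAME):
* §1 `map_subtype_unrKer_restrict_normal` — `K″ := Ker(Π_{H_{U'}} ↠ Π^unr)↑` is NORMAL in `Π_H` (closure of
  the normal closure of ALL `U' ⊓ Π_c^δ`, `U' ⊓ Π_e^δ`);
* §2 `map_subtype_unrTransport` — the push-forward of `unrTransport β (Π_X ⊔ Ker)` is
  `α(U ⊓ Π_v^{x_X}) ⊔ K″`; `classes_mod_unrKer_of_isUnrGroupTheoreticallyVerticial` — the vertex of `H_{U'}`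
  matched to a vertex of `G_U`, "graphic modulo `K″`";
* §3 `sep_mod_unrKer_of_unrVerticialOpenInter` — separation of the vertices of `H_{U'}` modulo `K″`;
* §4 `map_subtype_unrKer_map_eq` (`α(Ker↑) = Ker″↑`), `conj_mod_unrKer_of_map` (pull-back of the relation
  along `α⁻¹`).  The level-`U` PACKAGE for p421678's `isGroupTheoreticallyVerticial_of_graphic_mod` (the
  vertex bijection DERIVED from the class correspondence and separation on both sides) is assembled from
  these in `PSCUnrLevelPackage.lean`.
Pure plumbing; no definitions; nothing here takes a side on [IUTchIII] Cor. 3.12.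
-/

noncomputable section

namespace Literature.AnabelianGeometry.SemiGraphs

namespace PSCDatum

open scoped Pointwise
open PSCCovering

universe u

variable {P : Type u} [Group P] [TopologicalSpace P]
variable {P' : Type u} [Group P'] [TopologicalSpace P']

/-! ### 1. `Ker(Π_{H_{U'}} ↠ Π^unr)↑` is normal in `Π_H` -/

section UnrKerNormal

variable [IsTopologicalGroup P'] (H : PSCDatum P') (U' : Subgroup P') [U'.FiniteIndex] [U'.Normal]
  (hU' : IsOpen (U' : Set P'))

/-- Every `Π_H`-conjugate trace `U' ⊓ Π_e^δ` of a NODAL group lies in `Ker(Π_{H_{U'}} ↠ Π^unr)↑` (it is a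
`U'`-conjugate of a representative nodal group of `H_{U'}`). [cite: MochizukiCombGC2007, Def 1.1(ii) p.7] -/
theorem inf_conj_nodeGp_le_map_unrKer (e : H.graph.N) (δ : P') :
    U' ⊓ ConjAct.toConjAct δ • H.nodeGp e ≤ (H.restrict U' hU').unrKer.map U'.subtype := by
  obtain ⟨u, hu, k, hk, hrep⟩ := exists_dcRep_dcIdx_eq U' (H.nodeGp e) δ
  have hnode : ((H.restrict U' hU').nodeGp ⟨e, dcIdx U' (H.nodeGp e) δ⟩).map U'.subtype =
      ConjAct.toConjAct u • (U' ⊓ ConjAct.toConjAct δ • H.nodeGp e) := by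
    rw [restrict_nodeGp_map, nrep]
    change U' ⊓ ConjAct.toConjAct (dcRep U' (H.nodeGp e) (dcIdx U' (H.nodeGp e) δ)) • H.nodeGp e = _
    rw [hrep, conjAct_smul_inf_of_normal inferInstance, map_mul, mul_smul, map_mul, mul_smul,
      Subgroup.conjAct_pointwise_smul_eq_self (Subgroup.le_normalizer hk)]
  have hle' : ConjAct.toConjAct (⟨u, hu⟩ : U')⁻¹ •
      (H.restrict U' hU').nodeGp ⟨e, dcIdx U' (H.nodeGp e) δ⟩ ≤ (H.restrict U' hU').unrKer :=
    (H.restrict U' hU').smul_nodeGp_le_unrKer _ _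
  have := Subgroup.map_mono (f := U'.subtype) hle'
  rw [map_conj_smul, hnode, ← mul_smul] at this
  convert this using 2
  rw [ConjAct.ofConjAct_toConjAct, map_inv, Subgroup.coe_subtype, Subgroup.coe_mk, ← map_mul,
    inv_mul_cancel, map_one, one_smul]

/-- Every `U' ⊓ Π_c^δ` (cusps) lies in `Ker(Π_{H_{U'}} ↠ Π^unr)↑` (via `Ker(↠ Π^cpt) ≤ Ker(↠ Π^unr)`).
[cite: MochizukiCombGC2007, Def 1.1(ii) p.7] -/
theorem inf_conj_cuspGp_le_map_unrKer (c : H.graph.C) (δ : P') :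
    U' ⊓ ConjAct.toConjAct δ • H.cuspGp c ≤ (H.restrict U' hU').unrKer.map U'.subtype :=
  (H.inf_conj_cuspGp_le_map_cptKer U' hU' c δ).trans (Subgroup.map_mono (H.restrict U' hU').cptKer_le_unrKer)

/-- **`Ker(Π_{H_{U'}} ↠ Π^unr)↑` is normal in `Π_H`**: it is the closure of the normal closure of ALL the
`U' ⊓ Π_c^δ`, `U' ⊓ Π_e^δ`, a `Π_H`-stable family. [cite: MochizukiCombGC2007, Def 1.1(ii) p.7] -/
theorem map_subtype_unrKer_restrict_normal : ((H.restrict U' hU').unrKer.map U'.subtype).Normal := by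
  have hU'c : IsClosed (U' : Set P') := Subgroup.isClosed_of_isOpen U' hU'
  have hKc : IsClosed (((H.restrict U' hU').unrKer.map U'.subtype : Subgroup P') : Set P') := by
    have h1 : IsClosed (((H.restrict U' hU').unrKer : Subgroup U') : Set U') :=
      Subgroup.isClosed_topologicalClosure _
    rw [Subgroup.coe_map]
    exact hU'c.isClosedEmbedding_subtypeVal.isClosedMap _ h1
  let T : Set P' := (⋃ c : H.graph.C, ⋃ δ : P', ((U' ⊓ ConjAct.toConjAct δ • H.cuspGp c : Subgroup P') :
      Set P')) ∪ ⋃ e : H.graph.N, ⋃ δ : P', ((U' ⊓ ConjAct.toConjAct δ • H.nodeGp e : Subgroup P') : Set P')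
  let M : Subgroup P' := Subgroup.normalClosure T
  have hMn : M.Normal := Subgroup.normalClosure_normal
  have hMK : M ≤ (H.restrict U' hU').unrKer.map U'.subtype := by
    refine (Subgroup.closure_le _).mpr fun x hx => ?_
    obtain ⟨a, ha, hconj⟩ := Group.mem_conjugatesOfSet_iff.mp hx
    obtain ⟨g, rfl⟩ := isConj_iff.mp hconj
    rcases ha with ha | ha
    · simp only [Set.mem_iUnion, SetLike.mem_coe] at ha
      obtain ⟨c, δ, ha⟩ := ha
      have hx' : g * a * g⁻¹ ∈ U' ⊓ ConjAct.toConjAct (g * δ) • H.cuspGp c := by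
        rw [map_mul, mul_smul, ← conjAct_smul_inf_of_normal inferInstance,
          Subgroup.mem_pointwise_smul_iff_inv_smul_mem]
        simpa [ConjAct.smul_def, mul_assoc] using ha
      exact H.inf_conj_cuspGp_le_map_unrKer U' hU' c (g * δ) hx'
    · simp only [Set.mem_iUnion, SetLike.mem_coe] at ha
      obtain ⟨e, δ, ha⟩ := ha
      have hx' : g * a * g⁻¹ ∈ U' ⊓ ConjAct.toConjAct (g * δ) • H.nodeGp e := by
        rw [map_mul, mul_smul, ← conjAct_smul_inf_of_normal inferInstance,
          Subgroup.mem_pointwise_smul_iff_inv_smul_mem]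
        simpa [ConjAct.smul_def, mul_assoc] using ha
      exact H.inf_conj_nodeGp_le_map_unrKer U' hU' e (g * δ) hx'
  have hKM : (H.restrict U' hU').unrKer.map U'.subtype ≤ M.topologicalClosure := by
    have hgen : Subgroup.normalClosure ((⋃ d : (H.restrict U' hU').graph.C,
        (((H.restrict U' hU').cuspGp d : Subgroup U') : Set U')) ∪ ⋃ d : (H.restrict U' hU').graph.N,
        (((H.restrict U' hU').nodeGp d : Subgroup U') : Set U')) ≤ M.comap U'.subtype := by
      haveI : (M.comap U'.subtype).Normal := hMn.comap _
      refine Subgroup.normalClosure_le_normal ?_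
      intro u hu
      rw [SetLike.mem_coe, Subgroup.mem_comap]
      refine Subgroup.subset_normalClosure ?_
      rcases hu with hu | hu
      · simp only [Set.mem_iUnion, SetLike.mem_coe] at hu
        obtain ⟨d, hu⟩ := hu
        refine Or.inl ?_
        simp only [Set.mem_iUnion, SetLike.mem_coe]
        refine ⟨d.1, H.crep U' d, ?_⟩
        have : (u : P') ∈ ((H.restrict U' hU').cuspGp d).map U'.subtype := ⟨u, hu, rfl⟩
        rwa [restrict_cuspGp, Subgroup.subgroupOf_map_subtype, inf_comm] at this
      · simp only [Set.mem_iUnion, SetLike.mem_coe] at hu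
        obtain ⟨d, hu⟩ := hu
        refine Or.inr ?_
        simp only [Set.mem_iUnion, SetLike.mem_coe]
        refine ⟨d.1, H.nrep U' d, ?_⟩
        have : (u : P') ∈ ((H.restrict U' hU').nodeGp d).map U'.subtype := ⟨u, hu, rfl⟩
        rwa [restrict_nodeGp_map] at this
    intro x hx
    obtain ⟨u, hu, rfl⟩ := hx
    have hcl : (H.restrict U' hU').unrKer ≤ (M.topologicalClosure).comap U'.subtype := by
      refine Subgroup.topologicalClosure_minimal _ (hgen.trans ?_) ?_
      · exact Subgroup.comap_mono M.le_topologicalClosure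
      · exact (Subgroup.isClosed_topologicalClosure _).preimage continuous_subtype_val
    exact hcl hu
  have hMK' : M.topologicalClosure ≤ (H.restrict U' hU').unrKer.map U'.subtype :=
    Subgroup.topologicalClosure_minimal _ hMK hKc
  rw [le_antisymm hKM hMK']
  exact Subgroup.is_normal_topologicalClosure M

end UnrKerNormal

/-! ### 2. Push-forward of `unrTransport β` and the matched vertices -/

section Level

variable [IsTopologicalGroup P] [IsTopologicalGroup P']
variable (G : PSCDatum P) (H : PSCDatum P') (α : P ≃ₜ* P')
variable (U : Subgroup P) [U.FiniteIndex] [U.Normal] (hU : IsOpen (U : Set P)) (bd : G.BranchData)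
variable (U' : Subgroup P') [U'.FiniteIndex] [U'.Normal] (hU' : IsOpen (U' : Set P')) (bd' : H.BranchData)
variable (hUU' : U.map α.toMulEquiv.toMonoidHom = U')
variable (αU : U ≃ₜ* U') (hαU : ∀ u : U, ((αU u : U') : P') = α u)
variable (β : (U ⧸ (G.restrictBD U hU bd).unrKer) ≃ₜ* (U' ⧸ (H.restrictBD U' hU' bd').unrKer))
variable (hβ : ∀ u : U, β (QuotientGroup.mk' (G.restrictBD U hU bd).unrKer u) =
  QuotientGroup.mk' (H.restrictBD U' hU' bd').unrKer (αU u))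

include hαU hβ in
omit [U.Normal] [U'.Normal] in
/-- `β` over `α|_U` forces `α(Ker↑) ≤ Ker'↑` (an element of the kernel maps to `1`, hence so does its image).
[cite: MochizukiCombGC2007, Def 1.4(iii) p.10] -/
theorem map_subtype_unrKer_map_le :
    ((G.restrictBD U hU bd).unrKer.map U.subtype).map α.toMulEquiv.toMonoidHom ≤
      (H.restrictBD U' hU' bd').unrKer.map U'.subtype := by
  rintro _ ⟨_, ⟨u, hu, rfl⟩, rfl⟩
  refine ⟨αU u, ?_, (hαU u).symm ▸ rfl⟩
  have h1 : QuotientGroup.mk' (G.restrictBD U hU bd).unrKer u = 1 := (QuotientGroup.eq_one_iff u).mpr hu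
  have h2 := hβ u
  rw [h1, map_one] at h2
  exact (QuotientGroup.eq_one_iff _).mp h2.symm

include hαU hβ in
omit [U.Normal] [U'.Normal] in
/-- **Push-forward of the transport**: for `S ≤ Π_{G_U}` containing nothing in particular,
`(unrTransport β (S ⊔ Ker))↑ = α(S↑) ⊔ Ker'↑`. [cite: MochizukiCombGC2007, Def 1.4(iii) p.10] -/
theorem map_subtype_unrTransport_sup (S : Subgroup U) :
    ((G.restrictBD U hU bd).unrTransport (H.restrictBD U' hU' bd') β (S ⊔ (G.restrictBD U hU bd).unrKer)).map
        U'.subtype =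
      (S.map U.subtype).map α.toMulEquiv.toMonoidHom ⊔ (H.restrictBD U' hU' bd').unrKer.map U'.subtype := by
  unfold unrTransport
  rw [pullback_map_map α αU hαU β hβ, Subgroup.map_sup, Subgroup.map_sup, sup_assoc,
    sup_eq_right.mpr (map_subtype_unrKer_map_le G H α U hU bd U' hU' bd' αU hαU β hβ)]

/-- Push-forward of a conjugate of a level vertex group joined with the kernel.
[cite: MochizukiCombGC2007, Def 1.1(ii) p.7] -/
theorem map_subtype_conj_sup_unrKer (γ : ConjAct U') (S : Subgroup U') :
    (γ • S ⊔ (H.restrictBD U' hU' bd').unrKer).map U'.subtype =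
      ConjAct.toConjAct ((ConjAct.ofConjAct γ : U') : P') •
        (S.map U'.subtype ⊔ (H.restrictBD U' hU' bd').unrKer.map U'.subtype) := by
  have hKn : ((H.restrictBD U' hU' bd').unrKer.map U'.subtype).Normal :=
    H.map_subtype_unrKer_restrict_normal U' hU'
  rw [Subgroup.map_sup, map_conj_smul, Subgroup.smul_sup, hKn.conjAct]
  rfl

include hUU' hαU hβ in
/-- **The vertex of `H_{U'}` matched to a vertex of `G_U` by a group-theoretically verticial `β`**, read in
`Π_H` modulo `K″ = Ker(Π_{H_{U'}} ↠ Π^unr)↑`: for every vertex `X = U x Π_v` of `G_U` there is a vertex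
`Y = U' y Π_w` of `H_{U'}` with `α(U ⊓ Π_v^x) ⊔ K″` a `U'`-conjugate of `(U' ⊓ Π_w^y) ⊔ K″`; and conversely.
[cite: MochizukiCombGC2007, Thm 1.6(ii) p.14] -/
theorem matched_vertex_of_isUnrGroupTheoreticallyVerticial
    (hgt : (G.restrictBD U hU bd).IsUnrGroupTheoreticallyVerticial (H.restrictBD U' hU' bd') β)
    (v : G.graph.V) (x : P) :
    ∃ (w : H.graph.V) (y : P'), ∃ u' ∈ U',
      (U ⊓ ConjAct.toConjAct x • G.vertGp v).map α.toMulEquiv.toMonoidHom ⊔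
          (H.restrictBD U' hU' bd').unrKer.map U'.subtype =
        ConjAct.toConjAct u' • ((U' ⊓ ConjAct.toConjAct y • H.vertGp w) ⊔
          (H.restrictBD U' hU' bd').unrKer.map U'.subtype) := by
  have hKn : ((H.restrictBD U' hU' bd').unrKer.map U'.subtype).Normal :=
    H.map_subtype_unrKer_restrict_normal U' hU'
  set X : (G.restrictGraphBD U bd).V := ⟨v, dcIdx U (G.vertGp v) x⟩ with hX
  obtain ⟨A', ⟨⟨w₀, j₀⟩, γ', rfl⟩, htr⟩ :=
    hgt.1 _ ⟨(G.restrictBD U hU bd).vertGp X, ⟨X, 1, (one_smul _ _).symm⟩, rfl⟩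
  have hpush := congrArg (Subgroup.map U'.subtype) htr
  rw [map_subtype_unrTransport_sup G H α U hU bd U' hU' bd' αU hαU β hβ,
    map_subtype_conj_sup_unrKer H U' hU' bd'] at hpush
  have hL : ((G.restrictBD U hU bd).vertGp X).map U.subtype =
      U ⊓ ConjAct.toConjAct (G.vrep U ⟨v, dcIdx U (G.vertGp v) x⟩) • G.vertGp v :=
    restrict_vertGp_map hU ⟨v, dcIdx U (G.vertGp v) x⟩
  have hR : ((H.restrictBD U' hU' bd').vertGp ⟨w₀, j₀⟩).map U'.subtype =
      U' ⊓ ConjAct.toConjAct (H.vrep U' ⟨w₀, j₀⟩) • H.vertGp w₀ := restrict_vertGp_map hU' ⟨w₀, j₀⟩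
  rw [hL, hR] at hpush
  obtain ⟨u₁, hu₁, h₁⟩ := G.exists_inf_vrep_smul_eq U v x
  rw [h₁, map_conj_smul, ← conjAct_smul_sup_of_normal hKn] at hpush
  have hαu₁ : α u₁ ∈ U' := by rw [← hUU']; exact ⟨u₁, hu₁, rfl⟩
  refine ⟨w₀, H.vrep U' ⟨w₀, j₀⟩, (α u₁)⁻¹ * ((ConjAct.ofConjAct γ' : U') : P'),
    U'.mul_mem (U'.inv_mem hαu₁) (ConjAct.ofConjAct γ').2, ?_⟩
  rw [map_mul, map_inv, mul_smul, eq_inv_smul_iff]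
  exact hpush

include hUU' hαU hβ in
omit [U.Normal] in
/-- The converse matching (every vertex of `H_{U'}` is matched to a vertex of `G_U`).
[cite: MochizukiCombGC2007, Thm 1.6(ii) p.14] -/
theorem matched_vertex_of_isUnrGroupTheoreticallyVerticial'
    (hgt : (G.restrictBD U hU bd).IsUnrGroupTheoreticallyVerticial (H.restrictBD U' hU' bd') β)
    (w : H.graph.V) (y : P') :
    ∃ (v : G.graph.V) (x : P), ∃ u' ∈ U',
      (U ⊓ ConjAct.toConjAct x • G.vertGp v).map α.toMulEquiv.toMonoidHom ⊔
          (H.restrictBD U' hU' bd').unrKer.map U'.subtype =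
        ConjAct.toConjAct u' • ((U' ⊓ ConjAct.toConjAct y • H.vertGp w) ⊔
          (H.restrictBD U' hU' bd').unrKer.map U'.subtype) := by
  have hKn : ((H.restrictBD U' hU' bd').unrKer.map U'.subtype).Normal :=
    H.map_subtype_unrKer_restrict_normal U' hU'
  set Y : (H.restrictGraphBD U' bd').V := ⟨w, dcIdx U' (H.vertGp w) y⟩ with hY
  obtain ⟨B, ⟨A, ⟨⟨v₀, i₀⟩, γ, rfl⟩, rfl⟩, htr⟩ :=
    hgt.2 _ ⟨(H.restrictBD U' hU' bd').vertGp Y, ⟨Y, 1, (one_smul _ _).symm⟩, rfl⟩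
  have hpush := congrArg (Subgroup.map U'.subtype) htr
  rw [map_subtype_unrTransport_sup G H α U hU bd U' hU' bd' αU hαU β hβ, map_conj_smul, map_conj_smul,
    Subgroup.map_sup] at hpush
  have hL : ((G.restrictBD U hU bd).vertGp ⟨v₀, i₀⟩).map U.subtype =
      U ⊓ ConjAct.toConjAct (G.vrep U ⟨v₀, i₀⟩) • G.vertGp v₀ := restrict_vertGp_map hU ⟨v₀, i₀⟩
  have hR : ((H.restrictBD U' hU' bd').vertGp Y).map U'.subtype =
      U' ⊓ ConjAct.toConjAct (H.vrep U' ⟨w, dcIdx U' (H.vertGp w) y⟩) • H.vertGp w :=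
    restrict_vertGp_map hU' ⟨w, dcIdx U' (H.vertGp w) y⟩
  rw [hL, hR] at hpush
  obtain ⟨u₂, hu₂, h₂⟩ := H.exists_inf_vrep_smul_eq U' w y
  rw [h₂] at hpush
  have hmem : α.toMulEquiv.toMonoidHom (U.subtype (ConjAct.ofConjAct γ)) ∈ U' := by
    rw [← hUU']; exact ⟨_, (ConjAct.ofConjAct γ).2, rfl⟩
  refine ⟨v₀, G.vrep U ⟨v₀, i₀⟩, (α.toMulEquiv.toMonoidHom (U.subtype (ConjAct.ofConjAct γ)))⁻¹ * u₂,
    U'.mul_mem (U'.inv_mem hmem) hu₂, ?_⟩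
  rw [map_mul, map_inv, mul_smul, conjAct_smul_sup_of_normal hKn, ← hpush, Subgroup.smul_sup,
    ConjAct.ofConjAct_toConjAct, inv_smul_smul, hKn.conjAct]

omit [IsTopologicalGroup P] [U.FiniteIndex] [U.Normal] in
/-- **Separation of the vertices of `H_{U'}` modulo `K″`** from Prop. 1.2 (i), unramified case, for the
sturdy `H_{U'}` (`UnrVerticialOpenInterDeterminesVertex`, BY NAME). [cite: MochizukiCombGC2007, Prop 1.2(i) p.8] -/
theorem sep_mod_unrKer_of_unrVerticialOpenInter
    (hV : (H.restrictBD U' hU' bd').UnrVerticialOpenInterDeterminesVertex)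
    (hs : (H.restrictBD U' hU' bd').IsSturdy) {w₁ : H.graph.V} {y₁ : P'} {w₂ : H.graph.V} {y₂ : P'}
    (h : ∃ u' ∈ U', (U' ⊓ ConjAct.toConjAct y₁ • H.vertGp w₁) ⊔ (H.restrictBD U' hU' bd').unrKer.map U'.subtype =
      ConjAct.toConjAct u' • ((U' ⊓ ConjAct.toConjAct y₂ • H.vertGp w₂) ⊔
        (H.restrictBD U' hU' bd').unrKer.map U'.subtype)) :
    (⟨w₁, DoubleCoset.mk U' (H.vertGp w₁) y₁⟩ :
        Σ w, DoubleCoset.Quotient (U' : Set P') (H.vertGp w : Set P')) =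
      ⟨w₂, DoubleCoset.mk U' (H.vertGp w₂) y₂⟩ := by
  have hKn : ((H.restrictBD U' hU' bd').unrKer.map U'.subtype).Normal :=
    H.map_subtype_unrKer_restrict_normal U' hU'
  obtain ⟨u', hu', h⟩ := h
  obtain ⟨u₁, hu₁, h₁⟩ := H.exists_inf_vrep_smul_eq U' w₁ y₁
  obtain ⟨u₂, hu₂, h₂⟩ := H.exists_inf_vrep_smul_eq U' w₂ y₂
  have hgU' : u₁ * u' * u₂⁻¹ ∈ U' := U'.mul_mem (U'.mul_mem hu₁ hu') (U'.inv_mem hu₂)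
  -- the two unramified verticial groups of `H_{U'}`, pushed to `Π_H`
  have hP : ∀ Y : (H.restrictGraphBD U' bd').V,
      ((H.restrictBD U' hU' bd').vertGp Y ⊔ (H.restrictBD U' hU' bd').unrKer).map U'.subtype =
        (U' ⊓ ConjAct.toConjAct (H.vrep U' Y) • H.vertGp Y.1) ⊔
          (H.restrictBD U' hU' bd').unrKer.map U'.subtype := by
    intro Y
    rw [Subgroup.map_sup, restrictBD_vertGp, restrict_vertGp_map]
  have hrel : ((H.restrictBD U' hU' bd').vertGp ⟨w₁, dcIdx U' (H.vertGp w₁) y₁⟩ ⊔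
        (H.restrictBD U' hU' bd').unrKer).map U'.subtype =
      (ConjAct.toConjAct (⟨u₁ * u' * u₂⁻¹, hgU'⟩ : U') •
        (H.restrictBD U' hU' bd').vertGp ⟨w₂, dcIdx U' (H.vertGp w₂) y₂⟩ ⊔
          (H.restrictBD U' hU' bd').unrKer).map U'.subtype := by
    rw [map_subtype_conj_sup_unrKer H U' hU' bd', ← Subgroup.map_sup, hP, hP]
    change (U' ⊓ ConjAct.toConjAct (H.vrep U' ⟨w₁, dcIdx U' (H.vertGp w₁) y₁⟩) • H.vertGp w₁) ⊔ _ =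
      ConjAct.toConjAct (u₁ * u' * u₂⁻¹) •
        ((U' ⊓ ConjAct.toConjAct (H.vrep U' ⟨w₂, dcIdx U' (H.vertGp w₂) y₂⟩) • H.vertGp w₂) ⊔ _)
    rw [h₁, h₂, ← conjAct_smul_sup_of_normal hKn, h, ← conjAct_smul_sup_of_normal hKn, ← mul_smul,
      ← mul_smul, ← map_mul, ← map_mul]
    congr 2
    group
  have heq := Subgroup.map_injective U'.subtype_injective hrel
  have hX : (⟨w₁, dcIdx U' (H.vertGp w₁) y₁⟩ : (H.restrictGraphBD U' bd').V) =
      ⟨w₂, dcIdx U' (H.vertGp w₂) y₂⟩ := by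
    refine hV hs _ _ 1 (ConjAct.toConjAct (⟨u₁ * u' * u₂⁻¹, hgU'⟩ : U')) ?_
    exact isOpen_subgroupOf_inf_of_eq (by rw [one_smul]; exact heq)
  have hw : w₁ = w₂ := congrArg Sigma.fst hX
  subst hw
  have hidx : dcIdx U' (H.vertGp w₁) y₁ = dcIdx U' (H.vertGp w₁) y₂ := eq_of_heq (Sigma.mk.inj_iff.mp hX).2
  have hmk : DoubleCoset.mk U' (H.vertGp w₁) y₁ = DoubleCoset.mk U' (H.vertGp w₁) y₂ :=
    (dcEnum U' (H.vertGp w₁)).injective hidx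
  rw [hmk]

/-! ### 4. Kernel equality and the pull-back of the relation along `α⁻¹` -/

include hαU hβ in
omit [U.Normal] [U'.Normal] in
/-- `β` over `α|_U` (both bijective) forces `α(Ker↑) = Ker'↑`. [cite: MochizukiCombGC2007, Def 1.4(iii) p.10] -/
theorem map_subtype_unrKer_map_eq :
    ((G.restrictBD U hU bd).unrKer.map U.subtype).map α.toMulEquiv.toMonoidHom =
      (H.restrictBD U' hU' bd').unrKer.map U'.subtype := by
  refine le_antisymm (map_subtype_unrKer_map_le G H α U hU bd U' hU' bd' αU hαU β hβ) ?_
  rintro _ ⟨u', hu', rfl⟩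
  refine ⟨(αU.symm u' : U), ⟨αU.symm u', ?_, rfl⟩, ?_⟩
  · have h2 := hβ (αU.symm u')
    rw [ContinuousMulEquiv.apply_symm_apply] at h2
    have h3 : QuotientGroup.mk' (H.restrictBD U' hU' bd').unrKer u' = 1 :=
      (QuotientGroup.eq_one_iff u').mpr hu'
    rw [h3, ← map_one β] at h2
    exact (QuotientGroup.eq_one_iff _).mp (β.injective h2)
  · have := hαU (αU.symm u')
    rw [ContinuousMulEquiv.apply_symm_apply] at this
    exact this.symm

include hUU' hαU hβ in
omit [U.Normal] [U'.Normal] in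
/-- The level-`U` relation "graphic modulo `K″`" pulled back along `α⁻¹`: a `U'`-conjugacy between
`α(U ⊓ Π_{v₁}^{x₁}) ⊔ K″` and `α(U ⊓ Π_{v₂}^{x₂}) ⊔ K″` is a `U`-conjugacy between `(U ⊓ Π_{v₁}^{x₁}) ⊔ Ker↑` and
`(U ⊓ Π_{v₂}^{x₂}) ⊔ Ker↑`. [cite: MochizukiCombGC2007, Thm 1.6(ii) p.14] -/
theorem conj_mod_unrKer_of_map {v₁ v₂ : G.graph.V} {x₁ x₂ : P} {u' : P'} (hu' : u' ∈ U')
    (h : (U ⊓ ConjAct.toConjAct x₁ • G.vertGp v₁).map α.toMulEquiv.toMonoidHom ⊔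
        (H.restrictBD U' hU' bd').unrKer.map U'.subtype =
      ConjAct.toConjAct u' • ((U ⊓ ConjAct.toConjAct x₂ • G.vertGp v₂).map α.toMulEquiv.toMonoidHom ⊔
        (H.restrictBD U' hU' bd').unrKer.map U'.subtype)) :
    ∃ u ∈ U, (U ⊓ ConjAct.toConjAct x₁ • G.vertGp v₁) ⊔ (G.restrictBD U hU bd).unrKer.map U.subtype =
      ConjAct.toConjAct u • ((U ⊓ ConjAct.toConjAct x₂ • G.vertGp v₂) ⊔
        (G.restrictBD U hU bd).unrKer.map U.subtype) := by
  have hKeq := map_subtype_unrKer_map_eq G H α U hU bd U' hU' bd' αU hαU β hβ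
  refine ⟨α.symm u', ?_, ?_⟩
  · have : u' ∈ U.map α.toMulEquiv.toMonoidHom := hUU' ▸ hu'
    obtain ⟨u, hu, rfl⟩ := this
    change α.symm (α u) ∈ U
    rw [α.symm_apply_apply]
    exact hu
  · apply Subgroup.map_injective (f := α.toMulEquiv.toMonoidHom) α.injective
    rw [Subgroup.map_sup, hKeq, h, map_conj_smul, Subgroup.map_sup, hKeq]
    congr 2
    change u' = α (α.symm u')
    rw [α.apply_symm_apply]

end Level

end PSCDatum

end Literature.AnabelianGeometry.SemiGraphs
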